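import Summits.QuantumAdvantage.QuantumAdvantage.Theses.LinnikCubicClassGroups
import Literature.Computability.Cryptography.CubicClassTableCoins
import Literature.Computability.Cryptography.CubicClassTableSpecs

/-!
# Crux `LinnikCubicClassGroups.PureCubicClassGroupFBQP` (stmt-QuantumAdvantage-11544) — stub `stub_classTableSem`, part COINS

Line `arakelov-giant-step-cycle`, stub `stub_classTableSem` (S5b-P5b): clause (ii) of the structural interface of the ladder class
table. With `ℓb = 24 (size cap + 2)(50 + e + size |ps|)` coins per prime and `|ps| ℓb ≤ ℓκ`, the coin values `κ < 2^ℓκ` on which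
some prime's cube-root list is wrong are at most `|ps| 2^-(49+e+size|ps|) 2^ℓκ ≤ 2^-(40+e) 2^ℓκ` (`RootsSem`, `card_badCoins_le`),
and off them the table equals the COIN-FREE table (true roots in place of the root program) at the reduced position
(`classTableOpQ_congr_gens`).
-/

set_option linter.dupNamespace false

namespace Summit.QuantumAdvantage.QuantumAdvantage.Theorems.LinnikCubicClassGroups

open Literature.Computability.Cryptography
open Literature.Computability.Cryptography.CubicClassTable
open Literature.Computability.Complexity (uniformProb)

/-- `n 2^-(9 + size n) ≤ 1`... precisely `n (1/2)^(49+e+size n) ≤ (1/2)^(40+e)`. -/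
theorem num_badcoins (n e : ℕ) : (n : ℝ) * (1 / 2) ^ (49 + e + Nat.size n) ≤ (1 / 2) ^ (40 + e) := by
  have hn : (n : ℝ) < 2 ^ Nat.size n := by exact_mod_cast Nat.lt_size_self n
  have e1 : ((1 : ℝ) / 2) ^ (49 + e + Nat.size n) = (1 / 2) ^ (40 + e) * ((1 / 2) ^ 9 * (1 / 2) ^ Nat.size n) := by
    rw [← pow_add, ← pow_add]; congr 1; omega
  rw [e1]
  have h2 : (n : ℝ) * ((1 / 2) ^ 9 * (1 / 2) ^ Nat.size n) ≤ 1 := by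
    have hp : ((1 : ℝ) / 2) ^ Nat.size n * 2 ^ Nat.size n = 1 := by
      rw [div_pow, one_pow, div_mul_cancel₀ _ (by positivity)]
    have h0 : (0 : ℝ) ≤ (1 / 2) ^ Nat.size n := by positivity
    have h1 : (n : ℝ) * (1 / 2) ^ Nat.size n ≤ 1 := by nlinarith [mul_le_mul_of_nonneg_right hn.le h0]
    have h9 : ((1 : ℝ) / 2) ^ 9 ≤ 1 := by norm_num
    calc (n : ℝ) * ((1 / 2) ^ 9 * (1 / 2) ^ Nat.size n) = (1 / 2) ^ 9 * ((n : ℝ) * (1 / 2) ^ Nat.size n) := by ring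
      _ ≤ 1 * 1 := mul_le_mul h9 h1 (by positivity) zero_le_one
      _ = 1 := one_mul _
  calc (n : ℝ) * ((1 / 2) ^ (40 + e) * ((1 / 2) ^ 9 * (1 / 2) ^ Nat.size n))
      = (1 / 2) ^ (40 + e) * ((n : ℝ) * ((1 / 2) ^ 9 * (1 / 2) ^ Nat.size n)) := by ring
    _ ≤ (1 / 2) ^ (40 + e) * 1 := mul_le_mul_of_nonneg_left h2 (by positivity)
    _ = (1 / 2) ^ (40 + e) := mul_one _

open scoped Classical in
/-- **Clause (ii): the coins.** For the instance `I` and the bundle `F'` obtained from `F` by replacing the root program with the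
true cube roots: the bad coin values are few and off them the table of `F` is the table of `F'` at the reduced position. -/
theorem coins_clause (F : WalkFns) (I : Inst) (cap e : ℕ) (hroots : RootsSem F)
    (hps : ∀ p ∈ I.ps, p.Prime ∧ ¬ p ∣ 3 * I.m) (hpcap : ∀ p ∈ I.ps, p ≤ cap)
    (hℓb : I.ℓb = 24 * (Nat.size cap + 2) * (50 + e + Nat.size I.ps.length)) (hℓκ : I.ps.length * I.ℓb ≤ I.ℓκ) :
    ((((Finset.range (2 ^ I.ℓκ)).filter (fun κ => ∃ i < I.ps.length,
        F.roots (I.ps.getD i 0, I.m, List.ofFn fun q : Fin I.ℓb => Nat.testBit κ (i * I.ℓb + q)) ≠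
          (List.range (I.ps.getD i 0)).filter (fun r => r ^ 3 % I.ps.getD i 0 = I.m % I.ps.getD i 0))).card : ℕ) : ℝ) ≤
        (1 / 2) ^ (40 + e) * 2 ^ I.ℓκ ∧
      ∀ v : ℕ, (v / (I.W * 2 ^ I.ℓy)) % 2 ^ I.ℓκ ∉ (Finset.range (2 ^ I.ℓκ)).filter (fun κ => ∃ i < I.ps.length,
        F.roots (I.ps.getD i 0, I.m, List.ofFn fun q : Fin I.ℓb => Nat.testBit κ (i * I.ℓb + q)) ≠
          (List.range (I.ps.getD i 0)).filter (fun r => r ^ 3 % I.ps.getD i 0 = I.m % I.ps.getD i 0)) →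
        F.classTableOpQ I cap v =
          ({ F with roots := fun x => (List.range x.1).filter (fun r => r ^ 3 % x.1 = x.2.1 % x.1) } : WalkFns).classTableOpQ
            I cap (v % (I.W * 2 ^ I.ℓy)) := by
  set good : ℕ → List ℕ := fun p => (List.range p).filter (fun r => r ^ 3 % p = I.m % p) with hgood
  set F' : WalkFns := { F with roots := fun x => (List.range x.1).filter (fun r => r ^ 3 % x.1 = x.2.1 % x.1) } with hF'
  constructor
  · -- (a) few bad coin values
    set s' : ℕ := 49 + e + Nat.size I.ps.length with hs'
    have hper : ∀ i < I.ps.length, uniformProb I.ℓb {κ | F.roots (I.ps.getD i 0, I.m, κ) ≠ good (I.ps.getD i 0)} ≤ (1 / 2) ^ s' := by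
      intro i hi
      have hpi : I.ps.getD i 0 ∈ I.ps := by rw [List.getD_eq_getElem _ _ hi]; exact List.getElem_mem hi
      obtain ⟨hp, hpd⟩ := hps _ hpi
      refine hroots (I.ps.getD i 0) I.m hp hpd s' I.ℓb ?_
      have hsz : Nat.size (I.ps.getD i 0) ≤ Nat.size cap := Nat.size_le_size (hpcap _ hpi)
      rw [hℓb, hs']
      calc (49 + e + Nat.size I.ps.length + 1) * (24 * (Nat.size (I.ps.getD i 0) + 2))
          = 24 * (Nat.size (I.ps.getD i 0) + 2) * (50 + e + Nat.size I.ps.length) := by ring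
        _ ≤ 24 * (Nat.size cap + 2) * (50 + e + Nat.size I.ps.length) := by gcongr
    have h := card_badCoins_le F.roots good I.ps I.m I.ℓκ I.ℓb s' hℓκ hper
    refine h.trans ?_
    have := num_badcoins I.ps.length e
    rw [← hs'] at this
    nlinarith [show (0 : ℝ) ≤ 2 ^ I.ℓκ by positivity]
  · -- (b) off the bad set the table is the coin-free table at the reduced position
    intro v hv
    rw [Finset.mem_filter, not_and] at hv
    have hκ : I.κof v < 2 ^ I.ℓκ := Nat.mod_lt _ (by positivity)
    have hv' := hv (Finset.mem_range.mpr hκ)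
    push Not at hv'
    have hr : ∀ i < I.ps.length, F.roots (I.ps.getD i 0, I.m, I.coins v i) =
        F'.roots (I.ps.getD i 0, I.m, I.coins (v % (I.W * 2 ^ I.ℓy)) i) := by
      intro i hi
      have h := hv' i hi
      exact h
    refine WalkFns.classTableOpQ_congr_gens (F := F) (F' := F') rfl rfl cap
      (WalkFns.gT_congr_roots (F := F) (F' := F') (I := I) rfl hr) ?_ ?_
    · unfold Inst.Eof; rw [Nat.mod_mul_right_mod]
    · unfold Inst.jof; rw [Nat.mod_mul_right_div_self, Nat.mod_mod]


/-- **P5b helper `classTableSem_num_badcoins`** (registered): the union bound over the primes fits the coin budget. -/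
theorem classTableSem_num_badcoins : ∀ (n e : ℕ), (n : ℝ) * (1 / 2) ^ (49 + e + Nat.size n) ≤ (1 / 2) ^ (40 + e) :=
  fun n e => num_badcoins n e

end Summit.QuantumAdvantage.QuantumAdvantage.Theorems.LinnikCubicClassGroups
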